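import Summits.QuantumFields.QCD.Theses.QuarkMassMonotone
import HarnessLib.Audit

/-!
# Line `sign-split` for the crux `LatticeGapMonotone` (item stmt-QuantumFields-8905) — strategist's ALTERNATIVE line
# (PUBLISHED as an alternative, NOT passed through `ledger skeleton check`: the live skeleton `Lines/birth.lean` stays registered;
# adopt with `ledger skeleton check $(ledger crux dir stmt-QuantumFields-8905)/Lines/sign_split.lean --crux stmt-QuantumFields-8905`)

Route `QuarkMassMonotone` (sub-problem QCD), crux decl
`Summit.QuantumFields.QCD.Theses.QuarkMassMonotone.LatticeGapMonotone` (rank 2):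

  `∀ N_f reg (m ≤ m') Δ, RayCertificate(m) → (reg.scheme m 0 0).HasLatticeMassGap Δ → (reg.scheme m' 0 0).HasLatticeMassGap Δ`

for EVERY `reg : QCDRegularisation N_f` — in particular for every real sequence of inverse bare couplings `β_k`
and every sequence of bare Wilson masses `m_f(k) = m_crit(k) + a_k m_f/Z_m(k)` (`m_crit`, `Z_m > 0` free).

## Why this cut (strategist census `Cruxes/LatticeGapMonotone/STRATEGY-CENSUS.md`, §Negation / §Decomposition)

The only mechanism on record for "heavier quarks never refine the lattice" is the heavy-quark one: integrating
out `N_f` Wilson flavours shifts the plaquette coupling by `Δβ = 24 Ñ_f κ⁴ > 0` (`r = 1`; Montvay–Münster (5.35),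
Hasenfratz–DeGrand 1994 eq. (9)), and lattice masses `a·m(β)` are non-increasing in `β` — ON THE WILSON AXIS
`β ≥ 0`.  For `β < 0` the same positive shift LOWERS `|β_eff|`: the strong-coupling glueball mass `−4 log|u(β)|`
(`u ≈ β/18` odd in `β`) then INCREASES with `κ`, i.e. heavier quarks LENGTHEN the gluonic correlation length —
the mechanism reverses (and the birth line's pointwise `stub_uniformDomination` is false in that convergent
corner, although the crux itself is trivially true there: it only bites on NEAR-CRITICAL sequences, where the
heavier theory's lattice gap tends to `0`).  The crux therefore splits along two fault lines that any proof must
cross separately, each an `atTop`-EVENTUAL property of the regularisation (so that no piece can smuggle the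
others through interleaved steps):

* `stub_negCoupling` — the crux for `β_k < 0` eventually: frustrated `SU(3)` (plaquettes driven to the two
  conjugate centre elements), no reflection positivity, no transfer matrix, mechanism REVERSED.  Expected
  vacuous (charge conjugation broken ⇒ the certificate fails) or FALSE (near a continuous negative-coupling
  transition approached from the clustering side); it is an INSTANCE of the crux, so its refutation refutes the
  crux as typed (repair: guard `0 ≤ β_k`, which `closes` affords — the anchored regularisation has `β_k → +∞`).
  The disprover's named target; every proof of the crux owes it.
* `stub_deepHopping` — the crux on the Wilson axis (`0 ≤ β_k` eventually) when eventually SOME flavour of the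
  lighter tuple sits at bare mass `m_f(k) ≤ −1` (`κ_f ≥ 1/6`): beyond Lüscher's positivity range, where the
  tree's `qcdTransferGap` is junk — the strong/intermediate-coupling chiral regime (`κ_c(β) ∈ (1/6, 1/4]`),
  believed monotone (Kawamoto–Smit pion, Smit (7.38): `cosh m_π = 1 + (M²−4)(M²−1)/(2M²−3)` increasing in
  `M = m₀ + 4 > 2`), with link-reflection positivity / `T²` (Osterwalder–Seiler) as the only spectral handle.
* `stub_luscherRange` — the crux on the Wilson axis when eventually EVERY flavour of the lighter tuple has
  `m_f(k) > −1` (then so do the heavier tuple and the whole certified ray: the range is an up-set): here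
  `β ≥ 0 ∧ m_f > −1` are exactly the hypotheses under which Lüscher's positive transfer matrix and the tree's
  `qcdTransferGap N_f β S m` (QCDTransferMatrix.lean) are meaningful, so the node can be cut SPECTRALLY
  (census §Decomposition D3: gap-of-clustering / transfer-gap monotone in each bare mass / clustering-of-gap) —
  the continuum-relevant regime (`β_k → +∞`, honest `m_f(k) → m_c(β_k) ∈ (−1, 0)` for `β` large) and the one
  `closes` consumes.

`LatticeGapMonotone_of : Stmt.stub_negCoupling → Stmt.stub_deepHopping → Stmt.stub_luscherRange →
LatticeGapMonotone` is PROVED below (no `sorry` outside the three `stub_*`): a regularisation is eventually in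
one class, or two classes occur infinitely often — then `reg` is read along the increasing enumerations
`Nat.nth` of the two index sets (`regAlong`: same data along a strictly increasing sequence of steps, still
`a → 0`, `a·L → ∞`), every hypothesis (`∀ᶠ k` / pointwise) passes to the subsequences, the stubs apply, and the
two eventual bounds MERGE (constant `max C₁ C₂`; the enumerations cover `ℕ`).  Twice: first by the sign of
`β_k`, then, on the Wilson axis, by the Lüscher-range predicate of the lighter tuple.

## Negative knowledge honoured
* No `Disproof.lean` exists for this crux (2026-08-17); `ledger negatives --problem QuantumFields`: 5 entries,
  none on mass transport.  Refuter corners (rreview-0815T13-6 g0/g3, rreview1): the guard `0 ≤ β_k` /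
  asymptotic scaling was twice recommended as "free for closes"; this line makes the unguarded remainder a
  NAMED stub instead of an unspoken obligation, and corrects g3's "moderate negative β like β = 0": in the glue
  channel the sign flips as soon as `|β| > Δβ(κ)`.
* No stub is pointwise DOMINATION (refuted at `β < 0`, census §Strengthen S⁺1); no stub adds `HasMassScaling`,
  `0 < m_f` or `0 < Δ` (the composition needs the crux's exact generality); no bespoke admissibility predicate.
* Typing checklist 4c: no Bochner integral over a free function, no hand-picked threshold (`−1` is Lüscher's
  `κ < 1/6`, Montvay–Münster (4.111), the junk boundary of `qcdTransferGap`, not a tunable constant), no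
  determinantal / complex-action positivity claim.
-/

noncomputable section

namespace Summit.QuantumFields.QCD.Cruxes.LatticeGapMonotone.SignSplit

open Filter
open Literature.MathematicalPhysics.QuantumFieldTheory
open Summit.QuantumFields.QCD.Theses.QuarkMassMonotone

variable {Nf : ℕ}

/-! ## §0 Currency: a regularisation read along a subsequence of steps -/

/-- **`reg` read along the strictly increasing sequence of steps `φ`** (same spacings, couplings, volumes,
critical masses and mass renormalisations at the steps `φ 0 < φ 1 < ⋯`; `a ∘ φ → 0`, `(a·L) ∘ φ → ∞`). [folklore] -/
def regAlong (reg : QCDRegularisation Nf) (φ : ℕ → ℕ) (hφ : StrictMono φ) : QCDRegularisation Nf where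
  a := fun j => reg.a (φ j)
  a_pos := fun j => reg.a_pos (φ j)
  tendsto_a := reg.tendsto_a.comp hφ.tendsto_atTop
  β := fun j => reg.β (φ j)
  L := fun j => reg.L (φ j)
  tendsto_L := reg.tendsto_L.comp hφ.tendsto_atTop
  mcrit := fun j => reg.mcrit (φ j)
  Zm := fun j => reg.Zm (φ j)
  Zm_pos := fun j => reg.Zm_pos (φ j)

/-- **The crux at one instance** `(reg, m, m', Δ)`: order + ray certificate + gap at `m` ⟹ gap at `m'`
(so that `LatticeGapMonotone = ∀ Nf reg m m' Δ, CruxAt reg m m' Δ` definitionally). [folklore] -/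
def CruxAt (reg : QCDRegularisation Nf) (m m' : Fin Nf → ℝ) (Δ : ℝ) : Prop :=
  (∀ f, m f ≤ m' f) →
    (∀ᶠ k in atTop, ∀ t : ℝ, 0 ≤ t → ∃ δ : ℝ, 0 < δ ∧
      ∀ (R R' : ℕ) (A : QCDLatticeObservable Nf R) (B : QCDLatticeObservable Nf R'),
        ∃ (C : ℝ) (S₀ : ℕ), ∀ S : ℕ, S₀ ≤ S → ∀ n : ℕ, n ≤ S →
          ‖qcdLatticeConnectedCorr (reg.β k) (2 * S + 1) (fun f => (reg.scheme m 0 0).mq f k + t) A B n‖ ≤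
            C * Real.exp (-(δ * n))) →
    (reg.scheme m 0 0).HasLatticeMassGap Δ → (reg.scheme m' 0 0).HasLatticeMassGap Δ

theorem latticeGapMonotone_iff : LatticeGapMonotone ↔ ∀ (Nf : ℕ) (reg : QCDRegularisation Nf)
    (m m' : Fin Nf → ℝ) (Δ : ℝ), CruxAt reg m m' Δ := Iff.rfl

/-- A uniform lattice gap passes to every subsequence of steps (same constant). [folklore] -/
theorem hasLatticeMassGap_regAlong (reg : QCDRegularisation Nf) (φ : ℕ → ℕ) (hφ : StrictMono φ)
    (m : Fin Nf → ℝ) (Δ : ℝ) (h : (reg.scheme m 0 0).HasLatticeMassGap Δ) :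
    ((regAlong reg φ hφ).scheme m 0 0).HasLatticeMassGap Δ := by
  intro R R' A B
  obtain ⟨C, hC⟩ := h R R' A B
  refine ⟨C, ?_⟩
  filter_upwards [hφ.tendsto_atTop.eventually hC] with j hj
  exact hj

/-- **The crux instance passes DOWN to subsequences in its hypotheses**: if the instance holds for `reg` read
along `φ`, its hypotheses for `reg` give the conclusion along `φ`. [folklore] -/
theorem hasLatticeMassGap_regAlong_of_cruxAt (reg : QCDRegularisation Nf) (φ : ℕ → ℕ) (hφ : StrictMono φ)
    (m m' : Fin Nf → ℝ) (Δ : ℝ) (h : CruxAt (regAlong reg φ hφ) m m' Δ) (hle : ∀ f, m f ≤ m' f)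
    (hcert : ∀ᶠ k in atTop, ∀ t : ℝ, 0 ≤ t → ∃ δ : ℝ, 0 < δ ∧
      ∀ (R R' : ℕ) (A : QCDLatticeObservable Nf R) (B : QCDLatticeObservable Nf R'),
        ∃ (C : ℝ) (S₀ : ℕ), ∀ S : ℕ, S₀ ≤ S → ∀ n : ℕ, n ≤ S →
          ‖qcdLatticeConnectedCorr (reg.β k) (2 * S + 1) (fun f => (reg.scheme m 0 0).mq f k + t) A B n‖ ≤
            C * Real.exp (-(δ * n)))
    (hgap : (reg.scheme m 0 0).HasLatticeMassGap Δ) :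
    ((regAlong reg φ hφ).scheme m' 0 0).HasLatticeMassGap Δ := by
  refine h hle ?_ (hasLatticeMassGap_regAlong reg φ hφ m Δ hgap)
  filter_upwards [hφ.tendsto_atTop.eventually hcert] with j hj
  exact hj

/-! ## §1 Merging along two complementary enumerations -/

/-- If `p`, `q` jointly exhaust `ℕ` and both hold infinitely often, an `atTop`-eventual property holding along
the increasing enumerations of `{k | p k}` and of `{k | q k}` holds eventually. [folklore] -/
theorem eventually_of_eventually_nth_two {p q : ℕ → Prop} (hpq : ∀ k, p k ∨ q k)
    (hp : (setOf p).Infinite) (hq : (setOf q).Infinite) {P : ℕ → Prop}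
    (h₁ : ∀ᶠ j in atTop, P (Nat.nth p j)) (h₂ : ∀ᶠ j in atTop, P (Nat.nth q j)) :
    ∀ᶠ k in atTop, P k := by
  rw [eventually_atTop] at h₁ h₂ ⊢
  obtain ⟨J₁, hJ₁⟩ := h₁
  obtain ⟨J₂, hJ₂⟩ := h₂
  refine ⟨max (Nat.nth p J₁) (Nat.nth q J₂), fun k hk => ?_⟩
  rcases hpq k with hk' | hk'
  · obtain ⟨j, rfl⟩ : k ∈ Set.range (Nat.nth p) := by
      rw [Nat.range_nth_of_infinite hp]; exact hk'
    refine hJ₁ j ?_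
    by_contra hlt
    have h' : Nat.nth p j < Nat.nth p J₁ := Nat.nth_strictMono hp (lt_of_not_ge hlt)
    exact absurd (le_trans (le_max_left _ _) hk) (not_le.mpr h')
  · obtain ⟨j, rfl⟩ : k ∈ Set.range (Nat.nth q) := by
      rw [Nat.range_nth_of_infinite hq]; exact hk'
    refine hJ₂ j ?_
    by_contra hlt
    have h' : Nat.nth q j < Nat.nth q J₂ := Nat.nth_strictMono hq (lt_of_not_ge hlt)
    exact absurd (le_trans (le_max_right _ _) hk) (not_le.mpr h')

/-- **Merging two uniform lattice gaps** along complementary enumerations (constant `max C₁ C₂`). [folklore] -/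
theorem hasLatticeMassGap_of_nth_two (reg : QCDRegularisation Nf) (m : Fin Nf → ℝ) (Δ : ℝ)
    {p q : ℕ → Prop} (hpq : ∀ k, p k ∨ q k) (hp : (setOf p).Infinite) (hq : (setOf q).Infinite)
    (h₁ : ((regAlong reg (Nat.nth p) (Nat.nth_strictMono hp)).scheme m 0 0).HasLatticeMassGap Δ)
    (h₂ : ((regAlong reg (Nat.nth q) (Nat.nth_strictMono hq)).scheme m 0 0).HasLatticeMassGap Δ) :
    (reg.scheme m 0 0).HasLatticeMassGap Δ := by
  intro R R' A B
  obtain ⟨C₁, hC₁⟩ := h₁ R R' A B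
  obtain ⟨C₂, hC₂⟩ := h₂ R R' A B
  refine ⟨max C₁ C₂, ?_⟩
  have hmono : ∀ (k : ℕ) (C : ℝ), C ≤ max C₁ C₂ →
      (∀ S : ℕ, (reg.scheme m 0 0).L k ≤ S → ∀ n : ℕ, n ≤ S →
        ‖qcdLatticeConnectedCorr ((reg.scheme m 0 0).β k) (2 * S + 1)
            (fun fl => (reg.scheme m 0 0).mq fl k) A B n‖ ≤
          C * Real.exp (-(Δ * ((reg.scheme m 0 0).a k * n)))) →
      ∀ S : ℕ, (reg.scheme m 0 0).L k ≤ S → ∀ n : ℕ, n ≤ S →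
        ‖qcdLatticeConnectedCorr ((reg.scheme m 0 0).β k) (2 * S + 1)
            (fun fl => (reg.scheme m 0 0).mq fl k) A B n‖ ≤
          max C₁ C₂ * Real.exp (-(Δ * ((reg.scheme m 0 0).a k * n))) :=
    fun k C hC h S hS n hn => (h S hS n hn).trans (mul_le_mul_of_nonneg_right hC (Real.exp_pos _).le)
  refine eventually_of_eventually_nth_two hpq hp hq
    (P := fun k => ∀ S : ℕ, (reg.scheme m 0 0).L k ≤ S → ∀ n : ℕ, n ≤ S →
      ‖qcdLatticeConnectedCorr ((reg.scheme m 0 0).β k) (2 * S + 1)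
          (fun fl => (reg.scheme m 0 0).mq fl k) A B n‖ ≤
        max C₁ C₂ * Real.exp (-(Δ * ((reg.scheme m 0 0).a k * n)))) ?_ ?_
  · filter_upwards [hC₁] with j hj
    exact hmono _ C₁ (le_max_left _ _) hj
  · filter_upwards [hC₂] with j hj
    exact hmono _ C₂ (le_max_right _ _) hj

/-- **Eventual dichotomy ⟹ the crux instance** (the engine of both splits).  If along `reg` a predicate `p` of
the step either holds eventually, fails eventually, or — when both happen infinitely often — the crux instance
holds for `reg` read along each of the two increasing enumerations, then the crux instance holds for `reg`.
Stated with the two "pure" cases as hypotheses on `reg` itself and the mixed case on the restrictions. [folklore] -/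
theorem cruxAt_of_dichotomy (reg : QCDRegularisation Nf) (m m' : Fin Nf → ℝ) (Δ : ℝ) (p : ℕ → Prop)
    (hP : (∀ᶠ k in atTop, p k) → CruxAt reg m m' Δ)
    (hN : (∀ᶠ k in atTop, ¬ p k) → CruxAt reg m m' Δ)
    (hMix : ∀ (hp : (setOf p).Infinite) (hq : (setOf fun k => ¬ p k).Infinite),
      CruxAt (regAlong reg (Nat.nth p) (Nat.nth_strictMono hp)) m m' Δ ∧
        CruxAt (regAlong reg (Nat.nth fun k => ¬ p k) (Nat.nth_strictMono hq)) m m' Δ) :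
    CruxAt reg m m' Δ := by
  by_cases hev : ∀ᶠ k in atTop, p k
  · exact hP hev
  · by_cases hev' : ∀ᶠ k in atTop, ¬ p k
    · exact hN hev'
    · have hfp : ∃ᶠ k in atTop, p k := by simpa only [not_eventually, not_not] using hev'
      have hfn : ∃ᶠ k in atTop, ¬ p k := not_eventually.mp hev
      have hp : (setOf p).Infinite := Nat.frequently_atTop_iff_infinite.1 hfp
      have hq : (setOf fun k => ¬ p k).Infinite := Nat.frequently_atTop_iff_infinite.1 hfn
      obtain ⟨h₁, h₂⟩ := hMix hp hq
      intro hle hcert hgap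
      exact hasLatticeMassGap_of_nth_two reg m' Δ (fun k => em (p k)) hp hq
        (hasLatticeMassGap_regAlong_of_cruxAt reg _ _ m m' Δ h₁ hle hcert hgap)
        (hasLatticeMassGap_regAlong_of_cruxAt reg _ _ m m' Δ h₂ hle hcert hgap)

/-! ## §2 The three stub statements

Naming (for `ledger skeleton check`): the statement of the registered stub `stub_<name>` is `def Stmt.stub_<name>`. -/

/-- **(N) The crux on eventually NEGATIVE couplings** — `∀ᶠ k, reg.β k < 0`: frustrated `SU(3)`, no reflection
positivity, no transfer matrix; the heavy-quark mechanism is REVERSED there (`Δβ > 0` lowers `|β_eff|`).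
Why plausibly true anyway: deep in the negative axis charge conjugation is expected to break spontaneously
(plaquettes → the two conjugate centre elements), the torus state is the C-symmetric mixture, C-odd pairs do not
cluster, the certificate fails and the instance is vacuous; at small `|β|` all gaps are bounded below and the
instance is trivially true.  Why it might fail: along `β_k` approaching a CONTINUOUS negative-coupling
transition from the clustering side (or `β_k → −∞` if `SU(3)` stays C-symmetric and asymptotically free in
`|β|`), heavier quarks sit CLOSER to criticality and lose the rate `Δ` — then the crux as typed is false and the
route must guard `0 ≤ β_k`.  Size: open / expected refutable in principle, not cheaply. -/
def Stmt.stub_negCoupling : Prop :=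
  ∀ (Nf : ℕ) (reg : QCDRegularisation Nf) (m m' : Fin Nf → ℝ) (Δ : ℝ),
    (∀ᶠ k in atTop, reg.β k < 0) → (∀ f, m f ≤ m' f) →
    (∀ᶠ k in atTop, ∀ t : ℝ, 0 ≤ t → ∃ δ : ℝ, 0 < δ ∧
      ∀ (R R' : ℕ) (A : QCDLatticeObservable Nf R) (B : QCDLatticeObservable Nf R'),
        ∃ (C : ℝ) (S₀ : ℕ), ∀ S : ℕ, S₀ ≤ S → ∀ n : ℕ, n ≤ S →
          ‖qcdLatticeConnectedCorr (reg.β k) (2 * S + 1) (fun f => (reg.scheme m 0 0).mq f k + t) A B n‖ ≤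
            C * Real.exp (-(δ * n))) →
    (reg.scheme m 0 0).HasLatticeMassGap Δ → (reg.scheme m' 0 0).HasLatticeMassGap Δ

/-- **(D) The crux on the Wilson axis beyond Lüscher's range** — `∀ᶠ k, 0 ≤ reg.β k` and eventually SOME flavour
of the lighter tuple has bare mass `m_f(k) ≤ −1` (`κ_f ≥ 1/6`): the strong/intermediate-coupling chiral regime
(`κ_c(β) ∈ (1/6, 1/4]` for small `β`), where the one-step transfer matrix is not positive and `qcdTransferGap` is
junk.  Why plausibly true: the strong-coupling spectrum is increasing in `M = m₀ + 4` on the physical side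
`M > 2` (Kawamoto–Smit / Smit (7.38)–(7.41)); the sea shift `Δβ > 0` refines the lattice for `β ≥ 0`; a
two-step (link-reflection) transfer matrix exists for all `κ` (Osterwalder–Seiler).  Why it might fail: no
volume-uniform control of Wilson QCD near `κ_c` at strong coupling exists; the regime also contains `β_k → +∞`
with flavours parked at `m_f(k) ≤ −1` (deep doubler-side masses on a certified ray — unusual but typed).
Size: L–XL. -/
def Stmt.stub_deepHopping : Prop :=
  ∀ (Nf : ℕ) (reg : QCDRegularisation Nf) (m m' : Fin Nf → ℝ) (Δ : ℝ),
    (∀ᶠ k in atTop, 0 ≤ reg.β k) → (∀ᶠ k in atTop, ∃ f, (reg.scheme m 0 0).mq f k ≤ -1) → (∀ f, m f ≤ m' f) →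
    (∀ᶠ k in atTop, ∀ t : ℝ, 0 ≤ t → ∃ δ : ℝ, 0 < δ ∧
      ∀ (R R' : ℕ) (A : QCDLatticeObservable Nf R) (B : QCDLatticeObservable Nf R'),
        ∃ (C : ℝ) (S₀ : ℕ), ∀ S : ℕ, S₀ ≤ S → ∀ n : ℕ, n ≤ S →
          ‖qcdLatticeConnectedCorr (reg.β k) (2 * S + 1) (fun f => (reg.scheme m 0 0).mq f k + t) A B n‖ ≤
            C * Real.exp (-(δ * n))) →
    (reg.scheme m 0 0).HasLatticeMassGap Δ → (reg.scheme m' 0 0).HasLatticeMassGap Δ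

/-- **(L) The crux on the Wilson axis inside Lüscher's range** — `∀ᶠ k, 0 ≤ reg.β k` and eventually EVERY
flavour of the lighter tuple has `m_f(k) > −1` (hence so have the heavier tuple and the whole certified ray):
exactly the hypotheses (`β ≥ 0`, `κ_f < 1/6`) under which Lüscher's transfer matrix is bounded, self-adjoint
and strictly positive and the tree's `qcdTransferGap N_f β S m` is meaningful — the node to cut SPECTRALLY
(gap-of-clustering / `qcdTransferGap` non-decreasing in each bare mass at fixed `β ≥ 0` / clustering-of-gap,
census D3), and the regime `closes` consumes (`β_k → +∞`, honest `m_f(k) → m_c(β_k) ∈ (−1, 0)`).  Why plausibly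
true: Feynman–Hellmann on `aH = −log(𝕋/λ₀)` ("every level carries at least the vacuum's scalar density"),
the positive sea shift on the Wilson axis, GMOR near the chiral line, decoupling (`Λ_eff` increasing in the
heavy mass) in the heavy corner, and every fixed-`β` `κ_sea` scan.  Why it might fail: the sea-association sign
(anti-bag levels, singlet `0⁺⁺`/`η′` hairpins), signed split/odd-`N_f` weights, `k`-uniform constants in the
`(−1)^F`-twisted bookkeeping, unguarded `N_f` (≥ 17; many-flavour bulk lines at `β > 0`).  Size: XL — the
believed heart. -/
def Stmt.stub_luscherRange : Prop :=
  ∀ (Nf : ℕ) (reg : QCDRegularisation Nf) (m m' : Fin Nf → ℝ) (Δ : ℝ),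
    (∀ᶠ k in atTop, 0 ≤ reg.β k) → (∀ᶠ k in atTop, ∀ f, -1 < (reg.scheme m 0 0).mq f k) → (∀ f, m f ≤ m' f) →
    (∀ᶠ k in atTop, ∀ t : ℝ, 0 ≤ t → ∃ δ : ℝ, 0 < δ ∧
      ∀ (R R' : ℕ) (A : QCDLatticeObservable Nf R) (B : QCDLatticeObservable Nf R'),
        ∃ (C : ℝ) (S₀ : ℕ), ∀ S : ℕ, S₀ ≤ S → ∀ n : ℕ, n ≤ S →
          ‖qcdLatticeConnectedCorr (reg.β k) (2 * S + 1) (fun f => (reg.scheme m 0 0).mq f k + t) A B n‖ ≤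
            C * Real.exp (-(δ * n))) →
    (reg.scheme m 0 0).HasLatticeMassGap Δ → (reg.scheme m' 0 0).HasLatticeMassGap Δ

/-! ## §3 The registered stubs (the ONLY `sorry`s of this file) -/

/-- (N) the crux on eventually negative couplings — quarantined; expected vacuous-or-false. -/
theorem stub_negCoupling : Stmt.stub_negCoupling := by
  sorry

/-- (D) the crux on the Wilson axis beyond Lüscher's range — size L–XL. -/
theorem stub_deepHopping : Stmt.stub_deepHopping := by
  sorry

/-- (L) the crux on the Wilson axis inside Lüscher's range — size XL (the believed heart; spectral currency available). -/
theorem stub_luscherRange : Stmt.stub_luscherRange := by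
  sorry

/-! ## §4 Composition (kernel-checked; no `sorry` below this line) -/

/-- **The Wilson-axis crux from (D) and (L)** — split by the Lüscher-range predicate of the lighter tuple,
`p k := ∀ f, −1 < m_f(k)` (its negation is `∃ f, m_f(k) ≤ −1`). [folklore] -/
theorem wilsonAxis_of (hD : Stmt.stub_deepHopping) (hL : Stmt.stub_luscherRange) :
    ∀ (Nf : ℕ) (reg : QCDRegularisation Nf) (m m' : Fin Nf → ℝ) (Δ : ℝ),
    (∀ᶠ k in atTop, 0 ≤ reg.β k) → CruxAt reg m m' Δ := by
  intro Nf reg m m' Δ hβ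
  have hneg : ∀ (r : QCDRegularisation Nf) (k : ℕ),
      (¬ ∀ f, -1 < (r.scheme m 0 0).mq f k) ↔ ∃ f, (r.scheme m 0 0).mq f k ≤ -1 := by
    intro r k; simp only [not_forall, not_lt]
  refine cruxAt_of_dichotomy reg m m' Δ (fun k => ∀ f, -1 < (reg.scheme m 0 0).mq f k) ?_ ?_ ?_
  · exact fun hp => hL Nf reg m m' Δ hβ hp
  · intro hn
    exact hD Nf reg m m' Δ hβ (hn.mono fun k hk => (hneg reg k).mp hk)
  · intro hp hq
    refine ⟨hL Nf _ m m' Δ ?_ (Eventually.of_forall fun j => Nat.nth_mem_of_infinite hp j),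
      hD Nf _ m m' Δ ?_ (Eventually.of_forall fun j => (hneg reg _).mp (Nat.nth_mem_of_infinite hq j))⟩
    · exact (Nat.nth_strictMono hp).tendsto_atTop.eventually hβ
    · exact (Nat.nth_strictMono hq).tendsto_atTop.eventually hβ

/-- **The crux from the three stubs** (concludes `LatticeGapMonotone` BY NAME) — split by the sign predicate
`p k := 0 ≤ β_k` (negation `β_k < 0`), the Wilson-axis half supplied by `wilsonAxis_of`. [folklore] -/
theorem LatticeGapMonotone_of :
    Stmt.stub_negCoupling → Stmt.stub_deepHopping → Stmt.stub_luscherRange → LatticeGapMonotone := by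
  intro hN hD hL
  rw [latticeGapMonotone_iff]
  intro Nf reg m m' Δ
  have hW := wilsonAxis_of hD hL
  refine cruxAt_of_dichotomy reg m m' Δ (fun k => 0 ≤ reg.β k) ?_ ?_ ?_
  · exact fun hp => hW Nf reg m m' Δ hp
  · intro hn
    exact hN Nf reg m m' Δ (hn.mono fun k hk => lt_of_not_ge hk)
  · intro hp hq
    exact ⟨hW Nf _ m m' Δ (Eventually.of_forall fun j => Nat.nth_mem_of_infinite hp j),
      hN Nf _ m m' Δ (Eventually.of_forall fun j => lt_of_not_ge (Nat.nth_mem_of_infinite hq j))⟩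

/-! ## §5 Degenerate instances (BC5-in-kind): the definitions compute -/

/-- `N_f = 0`: the two schemes coincide and every stub statement's instance holds with no hypothesis used. [folklore] -/
theorem cruxAt_nf_zero (reg : QCDRegularisation 0) (m m' : Fin 0 → ℝ) (Δ : ℝ) : CruxAt reg m m' Δ := by
  intro _ _ h
  obtain rfl : m = m' := Subsingleton.elim _ _
  exact h

/-- `m = m'`: every instance is trivial (the certificate is not even needed). [folklore] -/
theorem cruxAt_self (reg : QCDRegularisation Nf) (m : Fin Nf → ℝ) (Δ : ℝ) : CruxAt reg m m Δ :=
  fun _ _ h => h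

end Summit.QuantumFields.QCD.Cruxes.LatticeGapMonotone.SignSplit

end
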